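import Mathlib.Analysis.Complex.RealDeriv
import Summits.Parity.GeneralizedHardyLittlewood.Theorems.BeyondDiagonalBeatsQuarter.OffDiagDualCostProfile
import Summits.Parity.GeneralizedHardyLittlewood.Theorems.BeyondDiagonalBeatsQuarter.OffDiagDualCostBessel
import Summits.Parity.GeneralizedHardyLittlewood.Theorems.BeyondDiagonalBeatsQuarter.OffDiagLevelSeparation
import HarnessLib

/-!
# Route `PrimeLevelFamEdge`, crux K_B (stmt-Parity-20343), line `diagonal_kernel_split` rev 4, plan Ω,
# node **L7c, part 3 — the derivative cost of the level factor in the variable `v = 1/q`**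
# (OMEGA-BLUEPRINT v4 §3c; companion of `OffDiagLevelSeparation`, `OffDiagMollifierSeparation`)

In one summand of the dual core the level `q` enters the analytic weight only through `v = 1/q`:
`2q̂(2π/q) = 2√v`, `W(d₁d₂y₁y₂/q̂²) = W(a v)` with `a = 4π²d₁d₂y₁y₂ > 0`, `J₁(4π√(αβy₁y₂)/(q(r+1))) = J₁(b v)`,
and, in the `(h₁, s)` coordinates of the block switch, the Fourier kernel
`e(−t₁h₁/(q(r+1)) − t₂(s/h₁ + ab/(h₁q(r+1)))) = e(−t₂s/h₁)·e(−κ v)` with `κ = (t₁h₁ + t₂ab/h₁)/(r+1)`.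
So the `q`-separation of the core (E18 route, L7) is ONE-dimensional Taylor in `v` — pointwise in the box
variables, before the box integral — of the LEVEL FACTOR
`Ψ(v) = W(a v) · J₁(b v) · e(−κ v)`, on sub-blocks of `[1/(2N), 1/N]`, with the sample points `t_q = 1/q`
(`LevelSeparation.norm_sum_mul_sub_separated_le_of_isOpen`). This file supplies its derivative cost:

* `abs_pow_mul_norm_iteratedDeriv_mul_le` / `…_of_geometric` — the weighted Leibniz rule over `ℂ`
  (pointwise `ContDiffAt`; twin of prover-2's real `abs_pow_mul_iteratedDeriv_mul_le`): weighted bounds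
  `|t|ⁱ‖f⁽ⁱ⁾‖ ≤ A αⁱ`, `|t|ʲ‖g⁽ʲ⁾‖ ≤ B βʲ` multiply to `A B (α+β)ⁿ`;
* `iteratedDeriv_cexp_mul_ofReal`, `abs_pow_mul_norm_iteratedDeriv_phase` — the phase `v ↦ e(−κv)`:
  `|t|ⁿ‖∂ⁿ e(−κ·)(t)‖ = (2π|κ||t|)ⁿ`;
* `iteratedDeriv_ofReal_comp_of_isOpen` — real factors seen in `ℂ` (locally, on an open set);
  `abs_pow_mul_norm_iteratedDeriv_cutoffW_ofReal_le` (`≤ n!`, tree `…cutoffW_comp_mul_le`),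
  `abs_pow_mul_norm_iteratedDeriv_besselJ_ofReal_le` (`≤ (|b||t|)ⁿ`, tree `…besselJ_comp_mul_le`);
* **`abs_pow_mul_norm_iteratedDeriv_levelFactor_le`** — `|t|ⁿ‖Ψ⁽ⁿ⁾(t)‖ ≤ n!·(1 + |b|t + 2π|κ|t)ⁿ` (`t, a > 0`);
* **`norm_iteratedDeriv_levelFactor_le_factorial`** — on `[v₀, 2v₀]`: `‖Ψ⁽ʲ⁾(v)‖ ≤ j!/ρʲ` for every `j`, with
  `ρ = v₀/(1 + 2|b|v₀ + 4π|κ|v₀)` — the analytic-type bound that `LevelSeparation.norm_taylorCoeff_le` /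
  `norm_sub_taylor_sum_le` consume (sub-block length `≤ ρ/2`, i.e. `≍ N/(Z q^{ε})` levels, coefficients `≤ 2^{−j}`,
  remainder `≤ J·2^{−J}`);
* `contDiffOn_levelFactor` — `Ψ ∈ C^∞(0, ∞)` (for the open-neighbourhood Taylor lemma);
* **`levelFactor_separation`** — the packaged statement on one sub-block `[t₀,t₀+ℓ] ⊆ [v₀,2v₀]`, `ℓ ≤ ρ/2`:
  `‖Σ_i c_i Ψ(t_i) − Σ_{j<J} C_j Σ_i c_i((t_i−t₀)/ℓ)^j‖ ≤ J 2^{−J} Σ‖c_i‖` with `‖C_j‖ ≤ 2^{−j}`.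

Pure one-variable calculus; no statement about the off-diagonal objects themselves (the factor `2√v`, the
mollifier trinomial in `(log M(q))⁻¹` and the box integral are for the assembly, L7d). Helper; closes nothing;
standard axioms. «The programme SEARCHES and TYPES; no claim about Landau–Siegel zeros, Theorems 1–2 of
arXiv:2211.02515 or a repaired Margin232 until a kernel theorem says so.»
-/

noncomputable section

open Finset Real Complex
open scoped Nat Topology

namespace Summit.Parity.GeneralizedHardyLittlewood.Theorems.BeyondDiagonalBeatsQuarter.LevelSeparation

open Literature.Analysis.FunctionSpaces (besselJ contDiff_besselJ_holds)
open Literature.NumberTheory.LFunctions.KMV2000 (cutoffW)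
open OffDiagPoissonTwisted (abs_pow_mul_iteratedDeriv_cutoffW_comp_mul_le abs_iteratedDeriv_besselJ_comp_mul_le
  contDiffAt_cutoffW_comp_mul)

/-! ### Weighted Leibniz rule over `ℂ` -/

/-- **Weighted Leibniz rule (complex values, at a point)**: if `|t|ⁱ‖f⁽ⁱ⁾(t)‖ ≤ Aᵢ` and `|t|ʲ‖g⁽ʲ⁾(t)‖ ≤ Bⱼ`
for `i, j ≤ n`, then `|t|ⁿ‖(fg)⁽ⁿ⁾(t)‖ ≤ Σ_{i ≤ n} C(n,i) Aᵢ B_{n−i}`. [folklore] -/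
theorem abs_pow_mul_norm_iteratedDeriv_mul_le {f g : ℝ → ℂ} {n : ℕ} {t : ℝ} (hf : ContDiffAt ℝ n f t)
    (hg : ContDiffAt ℝ n g t) {A B : ℕ → ℝ} (hA : ∀ i ≤ n, |t| ^ i * ‖iteratedDeriv i f t‖ ≤ A i)
    (hB : ∀ j ≤ n, |t| ^ j * ‖iteratedDeriv j g t‖ ≤ B j) :
    |t| ^ n * ‖iteratedDeriv n (fun s => f s * g s) t‖ ≤
      ∑ i ∈ Finset.range (n + 1), (n.choose i : ℝ) * A i * B (n - i) := by
  rw [iteratedDeriv_fun_mul hf hg]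
  refine (mul_le_mul_of_nonneg_left (norm_sum_le _ _) (by positivity)).trans ?_
  rw [Finset.mul_sum]
  refine Finset.sum_le_sum fun i hi => ?_
  have hi' : i ≤ n := Nat.lt_succ_iff.mp (Finset.mem_range.mp hi)
  have e : |t| ^ n * ‖(n.choose i : ℂ) * iteratedDeriv i f t * iteratedDeriv (n - i) g t‖ =
      (n.choose i : ℝ) * ((|t| ^ i * ‖iteratedDeriv i f t‖) * (|t| ^ (n - i) * ‖iteratedDeriv (n - i) g t‖)) := by
    rw [norm_mul, norm_mul, Complex.norm_natCast, ← pow_mul_pow_sub |t| hi']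
    ring
  rw [e, mul_assoc (n.choose i : ℝ) (A i)]
  have hA0 : 0 ≤ A i := le_trans (by positivity) (hA i hi')
  exact mul_le_mul_of_nonneg_left
    (mul_le_mul (hA i hi') (hB _ (Nat.sub_le n i)) (by positivity) hA0) (Nat.cast_nonneg _)

/-- **Weighted geometric bounds multiply**: `|t|ⁱ‖f⁽ⁱ⁾‖ ≤ A αⁱ` and `|t|ʲ‖g⁽ʲ⁾‖ ≤ B βʲ` (`i, j ≤ n`)
give `|t|ⁿ‖(fg)⁽ⁿ⁾(t)‖ ≤ A B (α + β)ⁿ`. [folklore] -/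
theorem abs_pow_mul_norm_iteratedDeriv_mul_le_of_geometric {f g : ℝ → ℂ} {n : ℕ} {t : ℝ}
    (hf : ContDiffAt ℝ n f t) (hg : ContDiffAt ℝ n g t) {A B α β : ℝ}
    (hA : ∀ i ≤ n, |t| ^ i * ‖iteratedDeriv i f t‖ ≤ A * α ^ i)
    (hB : ∀ j ≤ n, |t| ^ j * ‖iteratedDeriv j g t‖ ≤ B * β ^ j) :
    |t| ^ n * ‖iteratedDeriv n (fun s => f s * g s) t‖ ≤ A * B * (α + β) ^ n := by
  refine (abs_pow_mul_norm_iteratedDeriv_mul_le hf hg hA hB).trans (le_of_eq ?_)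
  rw [add_pow, Finset.mul_sum]
  exact Finset.sum_congr rfl fun i _ => by ring

/-! ### The phase factor `v ↦ e(−κ v)` -/

/-- `d/dv exp(c·v) = c·exp(c·v)` for a real variable `v` and complex `c`. [folklore] -/
theorem hasDerivAt_cexp_mul_ofReal (c : ℂ) (v : ℝ) :
    HasDerivAt (fun v : ℝ => Complex.exp (c * v)) (c * Complex.exp (c * v)) v := by
  have h1 : HasDerivAt (fun v : ℝ => c * (v : ℂ)) (c * 1) v :=
    ((hasDerivAt_id v).ofReal_comp).const_mul c
  rw [mul_one] at h1
  have h2 := (Complex.hasDerivAt_exp (c * (v : ℂ))).comp v h1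
  simpa [Function.comp_def, mul_comm] using h2

/-- `(d/dv)ⁿ exp(c·v) = cⁿ·exp(c·v)`. [folklore] -/
theorem iteratedDeriv_cexp_mul_ofReal (c : ℂ) (n : ℕ) :
    iteratedDeriv n (fun v : ℝ => Complex.exp (c * v)) = fun v : ℝ => c ^ n * Complex.exp (c * v) := by
  induction n with
  | zero => funext v; simp
  | succ n ih =>
    rw [iteratedDeriv_succ, ih]
    funext v
    have h := ((hasDerivAt_cexp_mul_ofReal c v).const_mul (c ^ n)).deriv
    rw [h, pow_succ]
    ring

/-- `v ↦ exp(c·v)` is smooth. [folklore] -/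
theorem contDiff_cexp_mul_ofReal (c : ℂ) {n : ℕ∞} : ContDiff ℝ n (fun v : ℝ => Complex.exp (c * v)) :=
  Complex.contDiff_exp.comp (contDiff_const.mul Complex.ofRealCLM.contDiff)

/-- The level phase `v ↦ e(−κv) = exp(−2πiκv)` in the form `exp(c·v)`, `c = −2πκ·i`. [folklore] -/
theorem phase_eq_cexp_mul (κ : ℝ) :
    (fun v : ℝ => Complex.exp (((-2 * π * κ * v : ℝ) : ℂ) * I)) =
      fun v : ℝ => Complex.exp ((((-2 * π * κ : ℝ) : ℂ) * I) * v) := by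
  funext v
  congr 1
  push_cast
  ring

/-- **Cost of the phase**: `|t|ⁿ‖(d/dv)ⁿ e(−κv) |_{v=t}‖ = (2π|κ||t|)ⁿ`. [folklore] -/
theorem abs_pow_mul_norm_iteratedDeriv_phase (κ t : ℝ) (n : ℕ) :
    |t| ^ n * ‖iteratedDeriv n (fun v : ℝ => Complex.exp (((-2 * π * κ * v : ℝ) : ℂ) * I)) t‖ =
      (2 * π * |κ| * |t|) ^ n := by
  rw [phase_eq_cexp_mul, iteratedDeriv_cexp_mul_ofReal]
  dsimp only
  have hexp : ‖Complex.exp ((((-2 * π * κ : ℝ) : ℂ) * I) * (t : ℂ))‖ = 1 := by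
    rw [show (((-2 * π * κ : ℝ) : ℂ) * I) * (t : ℂ) = ((-2 * π * κ * t : ℝ) : ℂ) * I by push_cast; ring]
    exact Complex.norm_exp_ofReal_mul_I _
  rw [norm_mul, norm_pow, hexp, mul_one, norm_mul, Complex.norm_real, Complex.norm_I, mul_one,
    Real.norm_eq_abs, ← mul_pow]
  congr 1
  rw [abs_mul, abs_mul, abs_neg, abs_two, abs_of_pos Real.pi_pos]
  ring

/-- Smoothness of the phase at a point. [folklore] -/
theorem contDiffAt_phase (κ : ℝ) (n : ℕ) (t : ℝ) :
    ContDiffAt ℝ n (fun v : ℝ => Complex.exp (((-2 * π * κ * v : ℝ) : ℂ) * I)) t := by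
  rw [phase_eq_cexp_mul]
  exact (contDiff_cexp_mul_ofReal _).contDiffAt

/-! ### Real factors seen in `ℂ` -/

/-- **Iterated derivatives commute with `ℝ ↪ ℂ`, locally**: if `g ∈ Cⁿ(U)` for an open `U`, then on `U`
`(d/dx)ⁿ (g : ℂ) = ((d/dx)ⁿ g : ℂ)`. [folklore] -/
theorem iteratedDeriv_ofReal_comp_of_isOpen {U : Set ℝ} (hU : IsOpen U) :
    ∀ (n : ℕ) {g : ℝ → ℝ}, ContDiffOn ℝ n g U →
      Set.EqOn (iteratedDeriv n (fun x => (g x : ℂ))) (fun x => ((iteratedDeriv n g x : ℝ) : ℂ)) U := by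
  intro n
  induction n with
  | zero => intro g _ x _; simp
  | succ n ih =>
    intro g hg x hx
    -- the first derivatives agree on `U`
    have hdiff : ∀ y ∈ U, DifferentiableAt ℝ g y := fun y hy =>
      (hg.contDiffAt (hU.mem_nhds hy)).differentiableAt (by simp)
    have hderiv : Set.EqOn (deriv (fun x => (g x : ℂ))) (fun x => ((deriv g x : ℝ) : ℂ)) U :=
      fun y hy => ((hdiff y hy).hasDerivAt.ofReal_comp).deriv
    -- `iteratedDeriv (n+1) F = iteratedDeriv n (deriv F)`, and `deriv F` agrees with `(deriv g : ℂ)` near `x`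
    rw [iteratedDeriv_succ', iteratedDeriv_succ']
    have hev : deriv (fun x => (g x : ℂ)) =ᶠ[𝓝 x] fun x => ((deriv g x : ℝ) : ℂ) :=
      Filter.eventuallyEq_of_mem (hU.mem_nhds hx) hderiv
    rw [(hev.iteratedDeriv n).eq_of_nhds]
    have hg' : ContDiffOn ℝ n (deriv g) U := hg.deriv_of_isOpen hU (by norm_cast)
    exact ih hg' hx

/-- **Cost of the `W`-factor, complex form**: `|t|ⁿ‖(d/dv)ⁿ (W(av) : ℂ)|_{v=t}‖ ≤ n!` for `a, t > 0`.
[cite: KowalskiMichelVanderKam2000, (21) p. 12 — derivation] -/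
theorem abs_pow_mul_norm_iteratedDeriv_cutoffW_ofReal_le {a : ℝ} (ha : 0 < a) (n : ℕ) {t : ℝ} (ht : 0 < t) :
    |t| ^ n * ‖iteratedDeriv n (fun v : ℝ => (cutoffW (a * v) : ℂ)) t‖ ≤ n ! := by
  have hcd : ContDiffOn ℝ n (fun v : ℝ => cutoffW (a * v)) (Set.Ioi 0) :=
    fun v hv => (contDiffAt_cutoffW_comp_mul ha hv n).contDiffWithinAt
  rw [iteratedDeriv_ofReal_comp_of_isOpen isOpen_Ioi n hcd ht, Complex.norm_real, Real.norm_eq_abs,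
    ← abs_pow, ← abs_mul]
  exact abs_pow_mul_iteratedDeriv_cutoffW_comp_mul_le ha n ht

/-- **Cost of the Bessel factor, complex form**: `|t|ⁿ‖(d/dv)ⁿ (J₁(bv) : ℂ)|_{v=t}‖ ≤ (|b|·|t|)ⁿ`.
[cite: Watson1944, §2.11 — derivation] -/
theorem abs_pow_mul_norm_iteratedDeriv_besselJ_ofReal_le (m : ℕ) (b : ℝ) (n : ℕ) (t : ℝ) :
    |t| ^ n * ‖iteratedDeriv n (fun v : ℝ => (besselJ m (b * v) : ℂ)) t‖ ≤ (|b| * |t|) ^ n := by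
  have hcd : ContDiffOn ℝ n (fun v : ℝ => besselJ m (b * v)) Set.univ :=
    ((contDiff_besselJ_holds m).comp (contDiff_const.mul contDiff_id)).contDiffOn
  rw [iteratedDeriv_ofReal_comp_of_isOpen isOpen_univ n hcd (Set.mem_univ t), Complex.norm_real,
    Real.norm_eq_abs, mul_pow, mul_comm]
  exact mul_le_mul_of_nonneg_right (abs_iteratedDeriv_besselJ_comp_mul_le n m b t) (by positivity)

/-- Smoothness at `t > 0` of the complex `W`-factor. [folklore] -/
theorem contDiffAt_cutoffW_ofReal {a : ℝ} (ha : 0 < a) {t : ℝ} (ht : 0 < t) (n : ℕ) :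
    ContDiffAt ℝ n (fun v : ℝ => (cutoffW (a * v) : ℂ)) t :=
  Complex.ofRealCLM.contDiff.contDiffAt.comp t (contDiffAt_cutoffW_comp_mul ha ht n)

/-- Smoothness of the complex Bessel factor. [folklore] -/
theorem contDiffAt_besselJ_ofReal (m : ℕ) (b : ℝ) (n : ℕ) (t : ℝ) :
    ContDiffAt ℝ n (fun v : ℝ => (besselJ m (b * v) : ℂ)) t :=
  Complex.ofRealCLM.contDiff.contDiffAt.comp t
    ((contDiff_besselJ_holds m).comp (contDiff_const.mul contDiff_id)).contDiffAt

/-! ### The level factor `Ψ(v) = W(av)·J₁(bv)·e(−κv)` -/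

/-- The `W·J` part: `|t|ⁿ‖(W(a·)J_m(b·))⁽ⁿ⁾(t)‖ ≤ n!·(1 + |b||t|)ⁿ` for `a, t > 0` — and the same with any
`N ≥ n` in place of `n!`'s index. [folklore] -/
theorem abs_pow_mul_norm_iteratedDeriv_WJ_le {a : ℝ} (ha : 0 < a) (m : ℕ) (b : ℝ) {N n : ℕ} (hn : n ≤ N)
    {t : ℝ} (ht : 0 < t) :
    |t| ^ n * ‖iteratedDeriv n (fun v : ℝ => (cutoffW (a * v) : ℂ) * (besselJ m (b * v) : ℂ)) t‖ ≤
      N ! * (1 + |b| * |t|) ^ n := by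
  have h := abs_pow_mul_norm_iteratedDeriv_mul_le_of_geometric (contDiffAt_cutoffW_ofReal ha ht n)
    (contDiffAt_besselJ_ofReal m b n t) (A := N !) (B := 1) (α := 1) (β := |b| * |t|) ?_ ?_
  · simpa using h
  · intro i hi
    rw [one_pow, mul_one]
    exact (abs_pow_mul_norm_iteratedDeriv_cutoffW_ofReal_le ha i ht).trans
      (by exact_mod_cast Nat.factorial_le (hi.trans hn))
  · intro j _
    rw [one_mul]
    exact abs_pow_mul_norm_iteratedDeriv_besselJ_ofReal_le m b j t

/-- **Cost of the level factor**: for `a, t > 0`,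
`|t|ⁿ‖Ψ⁽ⁿ⁾(t)‖ ≤ n!·(1 + |b| t + 2π|κ| t)ⁿ`, `Ψ(v) = W(av)·J₁(bv)·e(−κv)`
(each `v∂ᵥ` costs `1` on `W`, `|b|v` on the Bessel factor and `2π|κ|v` on the phase).
[cite: KowalskiMichelVanderKam2000, (21)–(23) p. 12 — derivation] -/
theorem abs_pow_mul_norm_iteratedDeriv_levelFactor_le {a : ℝ} (ha : 0 < a) (b κ : ℝ) (n : ℕ) {t : ℝ}
    (ht : 0 < t) :
    |t| ^ n * ‖iteratedDeriv n (fun v : ℝ => (cutoffW (a * v) : ℂ) * (besselJ 1 (b * v) : ℂ) *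
        Complex.exp (((-2 * π * κ * v : ℝ) : ℂ) * I)) t‖ ≤
      n ! * (1 + |b| * t + 2 * π * |κ| * t) ^ n := by
  have hWJ : ContDiffAt ℝ n (fun v : ℝ => (cutoffW (a * v) : ℂ) * (besselJ 1 (b * v) : ℂ)) t :=
    (contDiffAt_cutoffW_ofReal ha ht n).mul (contDiffAt_besselJ_ofReal 1 b n t)
  have h := abs_pow_mul_norm_iteratedDeriv_mul_le_of_geometric hWJ (contDiffAt_phase κ n t)
    (A := n !) (B := 1) (α := 1 + |b| * |t|) (β := 2 * π * |κ| * |t|)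
    (fun i hi => abs_pow_mul_norm_iteratedDeriv_WJ_le ha 1 b hi ht)
    (fun j _ => by rw [one_mul, abs_pow_mul_norm_iteratedDeriv_phase])
  rw [abs_of_pos ht] at h ⊢
  calc t ^ n * ‖iteratedDeriv n (fun v : ℝ => (cutoffW (a * v) : ℂ) * (besselJ 1 (b * v) : ℂ) *
          Complex.exp (((-2 * π * κ * v : ℝ) : ℂ) * I)) t‖
      ≤ n ! * 1 * (1 + |b| * t + 2 * π * |κ| * t) ^ n := by
        convert h using 2
    _ = n ! * (1 + |b| * t + 2 * π * |κ| * t) ^ n := by ring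

/-- **The level factor is smooth on `(0, ∞)`.** [folklore] -/
theorem contDiffOn_levelFactor {a : ℝ} (ha : 0 < a) (b κ : ℝ) (n : ℕ) :
    ContDiffOn ℝ n (fun v : ℝ => (cutoffW (a * v) : ℂ) * (besselJ 1 (b * v) : ℂ) *
        Complex.exp (((-2 * π * κ * v : ℝ) : ℂ) * I)) (Set.Ioi 0) := fun t ht =>
  (((contDiffAt_cutoffW_ofReal ha ht n).mul (contDiffAt_besselJ_ofReal 1 b n t)).mul
    (contDiffAt_phase κ n t)).contDiffWithinAt

/-- **Analytic-type bound on a dyadic window.** For `0 < v₀ ≤ v ≤ 2v₀` and every order `j`: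
`‖Ψ⁽ʲ⁾(v)‖ ≤ j!/ρʲ` with `ρ = v₀/(1 + 2|b|v₀ + 4π|κ|v₀)` — the shape consumed by
`LevelSeparation.norm_taylorCoeff_le` (coefficients `≤ (ℓ/ρ)ʲ`) and `norm_sub_taylor_sum_le(_of_isOpen)`
(remainder `≤ J (ℓ/ρ)ᴶ`), so that sub-blocks of length `ℓ ≤ ρ/2` in `v = 1/q` separate the level with
`J ≍ log N` universal sequences. [cite: KowalskiMichelVanderKam2000, (21)–(23) p. 12 — derivation] -/
theorem norm_iteratedDeriv_levelFactor_le_factorial {a : ℝ} (ha : 0 < a) (b κ : ℝ) {v₀ : ℝ} (hv₀ : 0 < v₀)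
    (j : ℕ) {v : ℝ} (hv : v ∈ Set.Icc v₀ (2 * v₀)) :
    ‖iteratedDeriv j (fun v : ℝ => (cutoffW (a * v) : ℂ) * (besselJ 1 (b * v) : ℂ) *
        Complex.exp (((-2 * π * κ * v : ℝ) : ℂ) * I)) v‖ ≤
      j ! / (v₀ / (1 + 2 * |b| * v₀ + 4 * π * |κ| * v₀)) ^ j := by
  have hvpos : 0 < v := lt_of_lt_of_le hv₀ hv.1
  have h := abs_pow_mul_norm_iteratedDeriv_levelFactor_le ha b κ j hvpos
  rw [abs_of_pos hvpos] at h
  set D := ‖iteratedDeriv j (fun v : ℝ => (cutoffW (a * v) : ℂ) * (besselJ 1 (b * v) : ℂ) *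
        Complex.exp (((-2 * π * κ * v : ℝ) : ℂ) * I)) v‖ with hD
  have hD0 : 0 ≤ D := norm_nonneg _
  have hK0 : 0 < 1 + 2 * |b| * v₀ + 4 * π * |κ| * v₀ := by positivity
  -- `(1 + |b|v + 2π|κ|v) ≤ (1 + 2|b|v₀ + 4π|κ|v₀)` and `v ≥ v₀`
  have hnum : 1 + |b| * v + 2 * π * |κ| * v ≤ 1 + 2 * |b| * v₀ + 4 * π * |κ| * v₀ := by
    have h2 : v ≤ 2 * v₀ := hv.2
    nlinarith [abs_nonneg b, abs_nonneg κ, Real.pi_pos, mul_nonneg (abs_nonneg κ) Real.pi_pos.le]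
  have hpow : (1 + |b| * v + 2 * π * |κ| * v) ^ j ≤ (1 + 2 * |b| * v₀ + 4 * π * |κ| * v₀) ^ j :=
    pow_le_pow_left₀ (by positivity) hnum j
  have hvj : v₀ ^ j ≤ v ^ j := pow_le_pow_left₀ hv₀.le hv.1 j
  rw [div_pow, div_div_eq_mul_div, le_div_iff₀ (pow_pos hv₀ j)]
  calc D * v₀ ^ j ≤ D * v ^ j := mul_le_mul_of_nonneg_left hvj hD0
    _ = v ^ j * D := mul_comm _ _
    _ ≤ j ! * (1 + |b| * v + 2 * π * |κ| * v) ^ j := h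
    _ ≤ j ! * (1 + 2 * |b| * v₀ + 4 * π * |κ| * v₀) ^ j := mul_le_mul_of_nonneg_left hpow (by positivity)

/-! ### The packaged separation of the level factor on one sub-block -/

/-- **Separation of the level factor on a sub-block `[t₀, t₀+ℓ] ⊆ [v₀, 2v₀]` of `v = 1/q`.** With
`ρ = v₀/(1 + 2|b|v₀ + 4π|κ|v₀)`, `0 < ℓ ≤ ρ/2` and `J ≥ 1`: for any finite family of sample points
`t_i ∈ [t₀, t₀+ℓ]` (e.g. `t_q = 1/q`) and complex weights `c_i`,
`‖Σ_i c_i Ψ(t_i) − Σ_{j<J} C_j · Σ_i c_i ((t_i − t₀)/ℓ)^j‖ ≤ J·2^{−J}·Σ_i ‖c_i‖`, where the coefficients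
`C_j = (ℓ^j/j!)·Ψ^{(j)}(t₀)` satisfy `‖C_j‖ ≤ 2^{−j}` and the universal sequences `((t_i − t₀)/ℓ)^j` are bounded
by `1` (`LevelSeparation.norm_rescaled_pow_le_one`).
[cite: KowalskiMichelVanderKam2000, (21)–(23) p. 12 — derivation] -/
theorem levelFactor_separation {a : ℝ} (ha : 0 < a) (b κ : ℝ) {v₀ t₀ ℓ : ℝ} (hv₀ : 0 < v₀) (hℓ : 0 < ℓ)
    (ht₀ : v₀ ≤ t₀) (ht₁ : t₀ + ℓ ≤ 2 * v₀)
    (hℓρ : ℓ ≤ v₀ / (1 + 2 * |b| * v₀ + 4 * π * |κ| * v₀) / 2) {J : ℕ} (hJ : 1 ≤ J)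
    {ι : Type*} (S : Finset ι) (c : ι → ℂ) (t : ι → ℝ) (ht : ∀ i ∈ S, t i ∈ Set.Icc t₀ (t₀ + ℓ)) :
    ‖∑ i ∈ S, c i * ((cutoffW (a * t i) : ℂ) * (besselJ 1 (b * t i) : ℂ) *
          Complex.exp (((-2 * π * κ * t i : ℝ) : ℂ) * I)) -
        ∑ j ∈ Finset.range J,
          (((ℓ ^ j / j ! : ℝ) : ℂ) * iteratedDeriv j (fun v : ℝ => (cutoffW (a * v) : ℂ) *
              (besselJ 1 (b * v) : ℂ) * Complex.exp (((-2 * π * κ * v : ℝ) : ℂ) * I)) t₀) *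
            ∑ i ∈ S, c i * ((((t i - t₀) / ℓ) ^ j : ℝ) : ℂ)‖ ≤
        J * (1 / 2) ^ J * ∑ i ∈ S, ‖c i‖ ∧
      ∀ j : ℕ, ‖((ℓ ^ j / j ! : ℝ) : ℂ) * iteratedDeriv j (fun v : ℝ => (cutoffW (a * v) : ℂ) *
          (besselJ 1 (b * v) : ℂ) * Complex.exp (((-2 * π * κ * v : ℝ) : ℂ) * I)) t₀‖ ≤ (1 / 2) ^ j := by
  set ρ : ℝ := v₀ / (1 + 2 * |b| * v₀ + 4 * π * |κ| * v₀) with hρ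
  have hρ0 : 0 < ρ := by positivity
  have hsub : Set.Icc t₀ (t₀ + ℓ) ⊆ Set.Ioi (0 : ℝ) := fun y hy => lt_of_lt_of_le hv₀ (ht₀.trans hy.1)
  have hwin : ∀ y ∈ Set.Icc t₀ (t₀ + ℓ), y ∈ Set.Icc v₀ (2 * v₀) := fun y hy =>
    ⟨ht₀.trans hy.1, hy.2.trans ht₁⟩
  have hratio : ℓ / ρ ≤ 1 / 2 := by rw [div_le_iff₀ hρ0]; linarith
  have hratio0 : 0 ≤ ℓ / ρ := div_nonneg hℓ.le hρ0.le
  have hfact : ∀ j : ℕ, ∀ y ∈ Set.Icc v₀ (2 * v₀), ‖iteratedDeriv j (fun v : ℝ => (cutoffW (a * v) : ℂ) *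
      (besselJ 1 (b * v) : ℂ) * Complex.exp (((-2 * π * κ * v : ℝ) : ℂ) * I)) y‖ ≤ j ! / ρ ^ j :=
    fun j y hy => by rw [hρ]; exact norm_iteratedDeriv_levelFactor_le_factorial ha b κ hv₀ j hy
  clear_value ρ
  refine ⟨?_, fun j => ?_⟩
  · -- remainder: `M = J!/ρ^J`, and `M ℓ^J/(J-1)! = J (ℓ/ρ)^J ≤ J 2^{-J}`
    have hM : ∀ y ∈ Set.Icc t₀ (t₀ + ℓ), ‖iteratedDeriv J (fun v : ℝ => (cutoffW (a * v) : ℂ) *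
        (besselJ 1 (b * v) : ℂ) * Complex.exp (((-2 * π * κ * v : ℝ) : ℂ) * I)) y‖ ≤ J ! / ρ ^ J :=
      fun y hy => hfact J y (hwin y hy)
    have h := norm_sum_mul_sub_separated_le_of_isOpen S c t hℓ hJ isOpen_Ioi hsub
      (contDiffOn_levelFactor ha b κ J) hM ht
    refine h.trans (mul_le_mul_of_nonneg_right ?_ (Finset.sum_nonneg fun i _ => norm_nonneg _))
    obtain ⟨n, rfl⟩ : ∃ n, J = n + 1 := ⟨J - 1, by omega⟩
    simp only [Nat.add_sub_cancel]
    have hn : (0 : ℝ) < n ! := by positivity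
    calc ((n + 1)! : ℝ) / ρ ^ (n + 1) * ℓ ^ (n + 1) / n !
        = ((n + 1 : ℕ) : ℝ) * (ℓ / ρ) ^ (n + 1) := by
          rw [Nat.factorial_succ, Nat.cast_mul, div_pow]
          field_simp
      _ ≤ ((n + 1 : ℕ) : ℝ) * (1 / 2) ^ (n + 1) :=
          mul_le_mul_of_nonneg_left (pow_le_pow_left₀ hratio0 hratio _) (by positivity)
  · -- coefficients: `(ℓ^j/j!)·‖Ψ^{(j)}(t₀)‖ ≤ (ℓ/ρ)^j ≤ 2^{-j}`
    have ht₀mem : t₀ ∈ Set.Icc v₀ (2 * v₀) := ⟨ht₀, by linarith⟩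
    have hD := hfact j t₀ ht₀mem
    have h1 := norm_taylorCoeff_le (G := fun v : ℝ => (cutoffW (a * v) : ℂ) * (besselJ 1 (b * v) : ℂ) *
        Complex.exp (((-2 * π * κ * v : ℝ) : ℂ) * I)) (s := Set.univ) (t₀ := t₀) (A := 1) hℓ.le hρ0
      (by rw [iteratedDerivWithin_univ, one_mul]; exact hD)
    rw [iteratedDerivWithin_univ, one_mul] at h1
    exact h1.trans (pow_le_pow_left₀ hratio0 hratio j)

end Summit.Parity.GeneralizedHardyLittlewood.Theorems.BeyondDiagonalBeatsQuarter.LevelSeparation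

end
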